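import Summits.Ventures.HodgeRepro2.T5HeckeDoubleCoset

/-!
# Hecke eigenvalues of one-dimensional representations: `T_g ↦ Σ_{xK ∈ KgK/K} χ(x)`

Kernel annex of the Tier-5 record (blind lane).  For an unramified character `χ` of `G`
(`χ : G →* kˣ` trivial on `K`), the line `k` with `G` acting through `χ` is `K`-spherical and the
double-coset operator `T_g = 1_{KgK}` of `T5HeckeDoubleCoset` acts on it by the scalar
`Σ_{xK ∈ KgK/K} χ(x)`; for the trivial character this is the degree `#(KgK/K)`, and when
`KgK = gK` (e.g. `G = F^×`, `K = O^×`, `g = ϖ`) it is `χ(g)` — the Satake parameter of an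
unramified character of a torus.

* `lineRep χ : Representation k G k`, `lineRep_apply`;
* `mem_invariants_lineRep` — `k = (lineRep χ)^K` when `χ|_K = 1`;
* `cosetChar χ hχ : G ⧸ K → k` — `χ` descended to `G ⧸ K`;
* `heckeSMul_doubleCosetOp_lineRep` — `T_g • v = (Σ_{x ∈ KgK/K} χ(x)) • v`;
* `heckeSMul_doubleCosetOp_trivial` — on the trivial representation `T_g • v = #(KgK/K) • v`;
* `heckeSMul_doubleCosetOp_lineRep_of_orbit_eq_singleton` — `KgK = gK ⇒ T_g • v = χ(g) • v`.

What stays prose: the identification of the unramified characters of the record's tori with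
`χ : G →* kˣ` trivial on `K`; the printed theorems.
-/

namespace Summit.Ventures.HodgeRepro2.T5HeckeCharacterEigenvalue

open T5HeckePermutationModule T5HeckeDoubleCoset LevelPositivity

variable {G : Type*} [Group G] {k : Type*} [Field k] {K : Subgroup G}

/-- The one-dimensional representation of `G` on `k` through the character `χ : G →* kˣ`. -/
def lineRep (χ : G →* kˣ) : Representation k G k where
  toFun g := (χ g : k) • LinearMap.id
  map_one' := by simp only [map_one, Units.val_one, one_smul]; rfl
  map_mul' g h := by
    ext
    simp only [map_mul, Units.val_mul, LinearMap.smul_apply, LinearMap.id_apply, Module.End.mul_apply,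
      smul_eq_mul, mul_assoc]

/-- `lineRep χ g x = χ(g) * x`. -/
theorem lineRep_apply (χ : G →* kˣ) (g : G) (x : k) : lineRep χ g x = (χ g : k) * x := by
  simp only [lineRep, MonoidHom.coe_mk, OneHom.coe_mk, LinearMap.smul_apply, LinearMap.id_apply,
    smul_eq_mul]

/-- For `χ` trivial on `K`, every `x ∈ k` is `K`-fixed. -/
theorem mem_invariants_lineRep (χ : G →* kˣ) (hχ : ∀ κ ∈ K, χ κ = 1) (x : k) :
    x ∈ invariants (lineRep χ) K := by
  rw [mem_invariants_iff]
  intro κ hκ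
  rw [lineRep_apply, hχ κ hκ, Units.val_one, one_mul]

/-- `(lineRep χ)^K = ⊤` for `χ` trivial on `K`. -/
theorem invariants_lineRep_eq_top (χ : G →* kˣ) (hχ : ∀ κ ∈ K, χ κ = 1) :
    invariants (lineRep χ) K = ⊤ :=
  eq_top_iff.2 fun x _ => mem_invariants_lineRep χ hχ x

/-- `χ` descended to `G ⧸ K` (for `χ` trivial on `K`). -/
def cosetChar (χ : G →* kˣ) (hχ : ∀ κ ∈ K, χ κ = 1) : G ⧸ K → k :=
  Quotient.lift (fun x : G => (χ x : k)) (fun x y hxy => by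
    have hxy' : x⁻¹ * y ∈ K := QuotientGroup.leftRel_apply.1 hxy
    have h := hχ _ hxy'
    rw [map_mul, map_inv, inv_mul_eq_one] at h
    rw [h])

/-- `cosetChar χ hχ (xK) = χ(x)`. -/
theorem cosetChar_mk (χ : G →* kˣ) (hχ : ∀ κ ∈ K, χ κ = 1) (x : G) :
    cosetChar χ hχ (x : G ⧸ K) = (χ x : k) := rfl

/-- The orbit map of `v ∈ (lineRep χ)^K` is `xK ↦ χ(x) * v`. -/
theorem orbitMap_lineRep (χ : G →* kˣ) (hχ : ∀ κ ∈ K, χ κ = 1) (v : k)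
    (hv : v ∈ invariants (lineRep χ) K) (x : G ⧸ K) :
    orbitMap (lineRep χ) v hv x = cosetChar χ hχ x * v := by
  induction x using QuotientGroup.induction_on with
  | H x => rw [orbitMap_mk, lineRep_apply, cosetChar_mk]

/-- **The Hecke eigenvalue of an unramified character**: `T_g • v = (Σ_{xK ∈ KgK/K} χ(x)) * v`. -/
theorem heckeSMul_doubleCosetOp_lineRep (χ : G →* kˣ) (hχ : ∀ κ ∈ K, χ κ = 1) (g : G)
    [Finite (MulAction.orbit K ((g : G) : G ⧸ K))] (v : invariants (lineRep χ) K) :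
    (heckeSMul (lineRep χ) (doubleCosetOp k K g) v : k) =
      (∑ᶠ x ∈ MulAction.orbit K ((g : G) : G ⧸ K), cosetChar χ hχ x) * (v : k) := by
  rw [heckeSMul_doubleCosetOp]
  simp only [orbitMap_lineRep χ hχ (v : k) v.2]
  rw [finsum_mem_eq_finite_toFinset_sum _ (Set.toFinite _),
    finsum_mem_eq_finite_toFinset_sum _ (Set.toFinite _), Finset.sum_mul]

/-- The trivial character: `T_g` acts on the trivial representation by its degree `#(KgK/K)`. -/
theorem heckeSMul_doubleCosetOp_lineRep_one (g : G)
    [Finite (MulAction.orbit K ((g : G) : G ⧸ K))] (v : invariants (lineRep (1 : G →* kˣ)) K) :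
    (heckeSMul (lineRep (1 : G →* kˣ)) (doubleCosetOp k K g) v : k) =
      ((MulAction.orbit K ((g : G) : G ⧸ K)).ncard : k) * (v : k) := by
  rw [heckeSMul_doubleCosetOp_lineRep (1 : G →* kˣ) (fun _ _ => rfl) g v]
  congr 1
  have : ∀ x : G ⧸ K, cosetChar (1 : G →* kˣ) (fun _ _ => rfl) x = 1 := fun x => by
    induction x using QuotientGroup.induction_on with
    | H x => rw [cosetChar_mk, MonoidHom.one_apply, Units.val_one]
  simp only [this]
  rw [finsum_mem_eq_finite_toFinset_sum _ (Set.toFinite _), Finset.sum_const, nsmul_eq_mul,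
    mul_one, Set.ncard_eq_toFinset_card _ (Set.toFinite _)]

/-- When the double coset `KgK` is the single coset `gK` (the torus case `K g K = g K`), `T_g` acts
on `lineRep χ` by `χ(g)` — the Satake parameter of the unramified character. -/
theorem heckeSMul_doubleCosetOp_lineRep_of_orbit_eq_singleton (χ : G →* kˣ)
    (hχ : ∀ κ ∈ K, χ κ = 1) (g : G)
    (horb : MulAction.orbit K ((g : G) : G ⧸ K) = {((g : G) : G ⧸ K)})
    (v : invariants (lineRep χ) K) :
    haveI : Finite (MulAction.orbit K ((g : G) : G ⧸ K)) := by rw [horb]; infer_instance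
    (heckeSMul (lineRep χ) (doubleCosetOp k K g) v : k) = (χ g : k) * (v : k) := by
  haveI : Finite (MulAction.orbit K ((g : G) : G ⧸ K)) := by rw [horb]; infer_instance
  rw [heckeSMul_doubleCosetOp_lineRep χ hχ g v]
  congr 1
  simp only [horb, finsum_mem_singleton, cosetChar_mk]

end Summit.Ventures.HodgeRepro2.T5HeckeCharacterEigenvalue
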